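import Summits.AtomisticToContinuum.FouriersLaw.Theses.PhononMeanFreePath
import Summits.AtomisticToContinuum.FouriersLaw.Theorems.BoundaryKubo.Negative.LoadBearing
import Literature.MathematicalPhysics.KineticTheory.LangevinChainH2Proof

/-!
# Locally uniform Harris bounds, helper 1: the Lyapunov condition H2 with constants uniform in the bath temperatures
(helpers for stub `stub_uniformHarris_of_minorization` of line `gibbs-ttcf`, crux stmt-AtomisticToContinuum-11812
`PhononMeanFreePath.BoundaryKubo`)

CEHR 2018 Theorem 5.1 / Remark 5.2 (H2 for `V = e^{θH}`) is proved in the tree for the constructed transition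
kernels of the pinned chain at ONE pair of bath temperatures (`CuneoEckmannHairerReyBellet2018_H2_holds`,
`LangevinChainH2Proof.lean`), with `∃ κ c K`. Its proof is explicit: the energy threshold `E₁ = K₅⁴` depends on
the temperatures only through the noise amplitudes `|√(2γT_L)| + |√(2γT_R)| + 1`, the a-priori factor
`e^{θγ(T_L+T_R)t*}` of (3.4) and the Hölder exponent `p = (1/(θ T_max) + 1)/2`, all three MONOTONE in the
temperatures. Re-running the same proof with these three quantities replaced by their values at a
temperature bound `Tm ≥ T_L, T_R` (`θ < 1/Tm`, quartic pinning `lam > 0`, so only the interaction regime of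
§5.1 occurs) gives:

* `pinnedChain_uniform_decay` — one threshold `E₁` such that `P^{T_L,T_R}_{t*} e^{θH}(z) ≤ e^{θH(z)}/2` for
  `H(z) ≥ E₁` and ALL `0 < T_L, T_R ≤ Tm`;
* `uniformHarris_uniformH2` (registered sub-goal) — H2 in the form of Remark 5.2 with `κ = 1/2`,
  `K = {H ≤ E₁}` and `c = e^{2θγ Tm t*} e^{θE₁}`, the same for all `0 < T_L, T_R ≤ Tm`.
-/

noncomputable section

open scoped NNReal ENNReal Topology
open MeasureTheory Filter Set

namespace Summit.AtomisticToContinuum.FouriersLaw.Theorems.BoundaryKubo.GibbsTtcf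

open Literature.MathematicalPhysics.KineticTheory.HeatConduction
open Literature.MathematicalPhysics.KineticTheory Literature.Probability.Process OscillatorChain
open ProbabilityTheory Literature.Analysis.ODE

section UniformDecay

variable {ω₂ lam β γ : ℝ} {N : ℕ}
variable (hω : 0 < ω₂) (hl : 0 < lam) (hβ : 0 < β) (hγ : 0 < γ) (hN : 0 < N)
include hω hl hβ hγ hN

set_option maxHeartbeats 3200000 in
/-- **CEHR Theorem 5.1 with a threshold uniform in the bath temperatures.** For the pinned chain with
quartic pinning (`ω₂, lam, β, γ > 0`, `N ≥ 1`), a temperature bound `Tm > 0`, `0 < θ < 1/Tm` and `t* > 0`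
there is `E₁` such that for ALL bath temperatures `0 < T_L, T_R ≤ Tm` and all `z` with `H(z) ≥ E₁`:
`P^{T_L,T_R}_{t*} e^{θH}(z) ≤ e^{θH(z)}/2`. The proof is that of `CuneoEckmannHairerReyBellet2018_H2_holds`
(interaction regime only, `limitChain_hamiltonian_ge_half_of_pos`), with the Hölder exponent
`p = (1/(θTm)+1)/2`, the noise-amplitude constant `2|√(2γTm)| + 1` and the a-priori factor
`e^{θγ(2Tm)t*}` in place of their temperature-dependent values, which they dominate.
[cite: CuneoEckmannHairerReyBellet2018, Thm 5.1 and Rem 5.2] -/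
theorem pinnedChain_uniform_decay {Tm θ : ℝ} (hTm : 0 < Tm) (hθ : 0 < θ) (hθ' : θ < 1 / Tm)
    (tstar : ℝ≥0) (htstar : 0 < tstar) :
    ∃ E₁ : ℝ, ∀ T_L T_R : ℝ, 0 < T_L → T_L ≤ Tm → 0 < T_R → T_R ≤ Tm →
      ∀ z : PhaseSpace N, E₁ ≤ (pinnedChain ω₂ lam β γ).hamiltonian N z →
        ∫⁻ y, ENNReal.ofReal (Real.exp (θ * (pinnedChain ω₂ lam β γ).hamiltonian N y))
            ∂((pinnedChain ω₂ lam β γ).transitionKernel N T_L T_R tstar z) ≤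
          ENNReal.ofReal (Real.exp (θ * (pinnedChain ω₂ lam β γ).hamiltonian N z) / 2) := by
  -- the Hölder exponent `p` with `1 < p`, `pθ < 1/Tm`
  have hθT0 : 0 < θ * Tm := mul_pos hθ hTm
  have hθT : θ * Tm < 1 := (lt_div_iff₀ hTm).1 hθ'
  obtain ⟨p, hpdef⟩ : ∃ p : ℝ, p = (1 / (θ * Tm) + 1) / 2 := ⟨_, rfl⟩
  have hp1 : 1 < p := by
    have h1 : 1 < 1 / (θ * Tm) := by rw [lt_div_iff₀ hθT0]; linarith only [hθT]
    rw [hpdef]; linarith only [h1]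
  have hpTm : p * θ < 1 / Tm := by
    rw [hpdef, lt_div_iff₀ hTm]
    have e : (1 / (θ * Tm) + 1) / 2 * θ * Tm = (1 + θ * Tm) / 2 := by
      field_simp
    rw [e]; linarith only [hθT]
  have hr0 : 0 < 1 - p⁻¹ := by have := inv_lt_one_of_one_lt₀ hp1; linarith only [this]
  -- the constants of the energy estimates (temperature-free)
  set A := pinnedChainScaleA γ N with hA
  have hA1 : 1 ≤ A := one_le_pinnedChainScaleA hγ.le N
  set c₁ := pinnedChainScaleC ω₂ lam β γ N with hc₁
  set B := pinnedChainScaleB ω₂ lam β γ N with hB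
  have hc₁0 : 0 ≤ c₁ := pinnedChainScaleC_nonneg hω.le hl.le hβ.le hγ.le N
  have hB0 : 0 ≤ B := pinnedChainScaleB_nonneg hω.le hl.le hβ.le hγ.le N
  obtain ⟨CI, hCI⟩ : ∃ CI : ℝ, CI = (A * c₁ + B) + N * (c₁ + 1 / 2) + N / 2 := ⟨_, rfl⟩
  have hCI0 : 0 ≤ CI := by rw [hCI]; positivity
  -- the noise-amplitude constant at the temperature bound
  obtain ⟨cs, hcs⟩ : ∃ cs : ℝ, cs = 2 * |Real.sqrt (2 * γ * Tm)| + 1 := ⟨_, rfl⟩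
  have hcs1 : 1 ≤ cs := by rw [hcs]; linarith only [abs_nonneg (Real.sqrt (2 * γ * Tm))]
  -- the a-priori factor at the temperature bound, the decay factor `κ₀` and its thresholds
  obtain ⟨G, hG⟩ : ∃ G : ℝ, G = Real.exp (θ * γ * (Tm + Tm) * tstar) := ⟨_, rfl⟩
  have hG1 : 1 ≤ G := by rw [hG]; apply Real.one_le_exp; positivity
  obtain ⟨κ₀, hκ₀⟩ : ∃ κ₀ : ℝ, κ₀ = 1 / (2 * G) := ⟨_, rfl⟩
  have hκ₀0 : 0 < κ₀ := by rw [hκ₀]; positivity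
  have hκ₀1 : κ₀ ≤ 1 / 2 := by
    rw [hκ₀, div_le_div_iff₀ (by positivity) (by norm_num)]; linarith only [hG1]
  obtain ⟨L₀, hL₀⟩ : ∃ L₀ : ℝ, L₀ = Real.log (2 / κ₀) := ⟨_, rfl⟩
  have hL₀0 : 0 ≤ L₀ := by
    rw [hL₀]; apply Real.log_nonneg; rw [le_div_iff₀ hκ₀0]; linarith only [hκ₀1]
  obtain ⟨y₀, hy₀⟩ : ∃ y₀ : ℝ, y₀ = κ₀ / (2 * G) := ⟨_, rfl⟩
  have hy₀0 : 0 < y₀ := by rw [hy₀]; positivity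
  obtain ⟨x₀, hx₀⟩ : ∃ x₀ : ℝ, x₀ = y₀ ^ (1 - p⁻¹)⁻¹ := ⟨_, rfl⟩
  have hx₀0 : 0 < x₀ := by rw [hx₀]; exact Real.rpow_pos_of_pos hy₀0 _
  -- the noise size `δ₀` of the dissipation lemma
  obtain ⟨δ₀, hδ₀⟩ : ∃ δ₀ : ℝ, δ₀ = 1 / (A + 1) := ⟨_, rfl⟩
  have hδ₀0 : 0 < δ₀ := by rw [hδ₀]; positivity
  have hδ₀1 : δ₀ ≤ 1 := by rw [hδ₀, div_le_one (by positivity)]; linarith only [hA1]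
  have hAδ : A * δ₀ * 1 ≤ 1 := by
    rw [hδ₀, mul_one, mul_one_div, div_le_one (by positivity)]; linarith only [hA1]
  -- the dissipation package of the interaction regime
  obtain ⟨KI, εI, hKI1, hεI, hI⟩ := pinnedChain_dissipation_ge_interaction (ω₂ := ω₂) (lam := lam)
    (β := β) (γ := γ) hω hl.le hβ hγ hN (Λ := 1) one_pos hδ₀0 hδ₀1 hAδ
  obtain ⟨CΦ, hCΦ⟩ : ∃ CΦ : ℝ, CΦ = N * (ω₂ * max 1 (8 / lam) + max 1 (8 / β)) / 2 := ⟨_, rfl⟩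
  have hCΦ0 : 0 ≤ CΦ := by rw [hCΦ]; positivity
  -- the scale threshold `K₅` and the energy threshold `E₁ = K₅⁴`
  obtain ⟨K₅, hK₅⟩ : ∃ K₅ : ℝ, K₅ = 1 + KI + (2 * CΦ + 1) + (A + 1) ^ 2 + 1 / (tstar : ℝ) +
      4 * cs ^ 2 + (2 * CI / εI) ^ 2 + 16 * cs ^ 4 / x₀ + 2 * L₀ / (θ * εI) := ⟨_, rfl⟩
  have hts0 : (0 : ℝ) < tstar := by exact_mod_cast htstar
  have hs1 : 0 ≤ KI := by linarith only [hKI1]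
  have hs3 : 0 ≤ 2 * CΦ + 1 := by positivity
  have hs4 : 0 ≤ (A + 1) ^ 2 := by positivity
  have hs5 : 0 ≤ 1 / (tstar : ℝ) := by positivity
  have hs6 : 0 ≤ 4 * cs ^ 2 := by positivity
  have hs7 : 0 ≤ (2 * CI / εI) ^ 2 := by positivity
  have hs9 : 0 ≤ 16 * cs ^ 4 / x₀ := by positivity
  have hs10 : 0 ≤ 2 * L₀ / (θ * εI) := by positivity
  obtain ⟨E₁, hE₁⟩ : ∃ E₁ : ℝ, E₁ = K₅ ^ 4 := ⟨_, rfl⟩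
  refine ⟨E₁, fun T_L T_R hTL hTLm hTR hTRm => ?_⟩
  -- the temperature-dependent quantities are dominated by their values at `Tm`
  have hTmax0 : 0 < max T_L T_R := lt_max_of_lt_left hTL
  have hTmaxle : max T_L T_R ≤ Tm := max_le hTLm hTRm
  have hθ'' : θ < 1 / max T_L T_R := hθ'.trans_le (one_div_le_one_div_of_le hTmax0 hTmaxle)
  have hpθ : p * θ < 1 / max T_L T_R := hpTm.trans_le (one_div_le_one_div_of_le hTmax0 hTmaxle)
  have hcsle : |Real.sqrt (2 * γ * T_L)| + |Real.sqrt (2 * γ * T_R)| + 1 ≤ cs := by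
    rw [hcs, abs_of_nonneg (Real.sqrt_nonneg _), abs_of_nonneg (Real.sqrt_nonneg _),
      abs_of_nonneg (Real.sqrt_nonneg _)]
    have h1 : Real.sqrt (2 * γ * T_L) ≤ Real.sqrt (2 * γ * Tm) :=
      Real.sqrt_le_sqrt (mul_le_mul_of_nonneg_left hTLm (by positivity))
    have h2 : Real.sqrt (2 * γ * T_R) ≤ Real.sqrt (2 * γ * Tm) :=
      Real.sqrt_le_sqrt (mul_le_mul_of_nonneg_left hTRm (by positivity))
    linarith only [h1, h2]
  have hcs0' : 0 ≤ |Real.sqrt (2 * γ * T_L)| + |Real.sqrt (2 * γ * T_R)| + 1 := by positivity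
  have hGle : Real.exp (θ * γ * (T_L + T_R) * tstar) ≤ G := by
    rw [hG]; refine Real.exp_le_exp.2 ?_
    have h1 : T_L + T_R ≤ Tm + Tm := add_le_add hTLm hTRm
    have h2 : 0 ≤ θ * γ := by positivity
    have h3 : (0 : ℝ) ≤ tstar := hts0.le
    nlinarith [mul_nonneg (mul_nonneg h2 (sub_nonneg.2 h1)) h3]
  have hκG : κ₀ * Real.exp (θ * γ * (T_L + T_R) * tstar) ≤ 1 / 2 := by
    have hG0 : G ≠ 0 := by linarith only [hG1]
    calc κ₀ * Real.exp (θ * γ * (T_L + T_R) * tstar) ≤ κ₀ * G :=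
          mul_le_mul_of_nonneg_left hGle hκ₀0.le
      _ = 1 / 2 := by rw [hκ₀]; field_simp
  refine pinnedChain_decay_of_window hω hl.le hβ hγ hN hTL hTR hθ hθ'' tstar (E₁ := E₁) (κ₀ := κ₀)
    hκG ?_
  intro z hz
  -- the scale of `z`: `K = H(z)^{1/4} ≥ K₅`
  have hHz0 : 0 ≤ (pinnedChain ω₂ lam β γ).hamiltonian N z :=
    pinnedChain_hamiltonian_nonneg hω.le hl.le hβ.le γ N z
  obtain ⟨K, hKdef⟩ : ∃ K : ℝ, K = Real.sqrt (Real.sqrt ((pinnedChain ω₂ lam β γ).hamiltonian N z)) :=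
    ⟨_, rfl⟩
  have hK4 : K ^ 4 = (pinnedChain ω₂ lam β γ).hamiltonian N z := by
    rw [hKdef, show (4 : ℕ) = 2 * 2 from rfl, pow_mul, Real.sq_sqrt (Real.sqrt_nonneg _),
      Real.sq_sqrt hHz0]
  have hK₅1 : 1 ≤ K₅ := by rw [hK₅]; linarith only [hs1, hs3, hs4, hs5, hs6, hs7, hs9, hs10]
  have hK5 : K₅ ≤ K := by
    rw [hKdef, Real.le_sqrt (by linarith only [hK₅1]) (Real.sqrt_nonneg _),
      Real.le_sqrt (by positivity) hHz0]
    calc (K₅ ^ 2) ^ 2 = E₁ := by rw [hE₁]; ring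
      _ ≤ _ := hz
  have hthr : ∀ x : ℝ, x ≤ K₅ → x ≤ K := fun x hx => hx.trans hK5
  have hK1 : 1 ≤ K := hthr 1 (by rw [hK₅]; linarith only [hs1, hs3, hs4, hs5, hs6, hs7, hs9, hs10])
  have hK0 : 0 < K := by linarith only [hK1]
  have hKI : KI ≤ K := hthr _ (by rw [hK₅]; linarith only [hs1, hs3, hs4, hs5, hs6, hs7, hs9, hs10])
  have hKΦ' : 2 * CΦ + 1 ≤ K :=
    hthr _ (by rw [hK₅]; linarith only [hs1, hs3, hs4, hs5, hs6, hs7, hs9, hs10])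
  have hKA2 : (A + 1) ^ 2 ≤ K :=
    hthr _ (by rw [hK₅]; linarith only [hs1, hs3, hs4, hs5, hs6, hs7, hs9, hs10])
  have hKt : 1 / (tstar : ℝ) ≤ K :=
    hthr _ (by rw [hK₅]; linarith only [hs1, hs3, hs4, hs5, hs6, hs7, hs9, hs10])
  have hKcs : 4 * cs ^ 2 ≤ K :=
    hthr _ (by rw [hK₅]; linarith only [hs1, hs3, hs4, hs5, hs6, hs7, hs9, hs10])
  have hKeI : (2 * CI / εI) ^ 2 ≤ K :=
    hthr _ (by rw [hK₅]; linarith only [hs1, hs3, hs4, hs5, hs6, hs7, hs9, hs10])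
  have hKx : 16 * cs ^ 4 / x₀ ≤ K :=
    hthr _ (by rw [hK₅]; linarith only [hs1, hs3, hs4, hs5, hs6, hs7, hs9, hs10])
  have hKLI : 2 * L₀ / (θ * εI) ≤ K :=
    hthr _ (by rw [hK₅]; linarith only [hs1, hs3, hs4, hs5, hs6, hs7, hs9, hs10])
  have hz1 : K ^ 4 ≤ (pinnedChain ω₂ lam β γ).hamiltonian N z := hK4.le
  have hz2 : (pinnedChain ω₂ lam β γ).hamiltonian N z ≤ 2 * K ^ 4 := by
    rw [← hK4]; linarith only [pow_nonneg hHz0 1, sq_nonneg (K ^ 2)]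
  -- `M = √K`
  obtain ⟨M, hM⟩ : ∃ M : ℝ, M = Real.sqrt K := ⟨_, rfl⟩
  have hMK : M * M = K := by rw [hM]; exact Real.mul_self_sqrt hK0.le
  have hM1 : 1 ≤ M := by rw [hM, Real.le_sqrt (by norm_num) hK0.le]; simpa using hK1
  have hM0 : 0 < M := by linarith only [hM1]
  have hAM' : A + 1 ≤ M := by rw [hM, Real.le_sqrt (by positivity) hK0.le]; exact hKA2
  have hMδ : M ≤ δ₀ * K := by
    rw [hδ₀, one_div, le_inv_mul_iff₀ (by positivity : 0 < A + 1)]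
    calc (A + 1) * M ≤ M * M := mul_le_mul_of_nonneg_right hAM' hM0.le
      _ = K := hMK
  have hAM : A * M ≤ K := by
    calc A * M ≤ M * M := mul_le_mul_of_nonneg_right (by linarith only [hAM']) hM0.le
      _ = K := hMK
  have hbadK : 16 * cs ^ 4 / K ≤ x₀ := by
    rw [div_le_iff₀ hK0]
    have := hKx
    rw [div_le_iff₀ hx₀0] at this
    linarith only [this]
  have hKcs' : 4 * (|Real.sqrt (2 * γ * T_L)| + |Real.sqrt (2 * γ * T_R)| + 1) ^ 2 ≤ K := by
    have h1 : (|Real.sqrt (2 * γ * T_L)| + |Real.sqrt (2 * γ * T_R)| + 1) ^ 2 ≤ cs ^ 2 :=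
      pow_le_pow_left₀ hcs0' hcsle 2
    linarith only [h1, hKcs]
  have hbadK' : 16 * (|Real.sqrt (2 * γ * T_L)| + |Real.sqrt (2 * γ * T_R)| + 1) ^ 4 / K ≤
      (κ₀ / (2 * Real.exp (θ * γ * (T_L + T_R) * tstar))) ^ (1 - p⁻¹)⁻¹ := by
    have h1 : (|Real.sqrt (2 * γ * T_L)| + |Real.sqrt (2 * γ * T_R)| + 1) ^ 4 ≤ cs ^ 4 :=
      pow_le_pow_left₀ hcs0' hcsle 4
    have h2 : 16 * (|Real.sqrt (2 * γ * T_L)| + |Real.sqrt (2 * γ * T_R)| + 1) ^ 4 / K ≤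
        16 * cs ^ 4 / K := div_le_div_of_nonneg_right (by linarith only [h1]) hK0.le
    have h3 : y₀ ≤ κ₀ / (2 * Real.exp (θ * γ * (T_L + T_R) * tstar)) := by
      rw [hy₀]
      exact div_le_div_of_nonneg_left hκ₀0.le (by positivity) (by linarith only [hGle])
    have h4 : x₀ ≤ (κ₀ / (2 * Real.exp (θ * γ * (T_L + T_R) * tstar))) ^ (1 - p⁻¹)⁻¹ := by
      rw [hx₀]
      exact Real.rpow_le_rpow hy₀0.le h3 (inv_nonneg.2 hr0.le)
    exact (h2.trans hbadK).trans h4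
  have hMeI : 2 * CI ≤ εI * M := by
    have h1 : 2 * CI / εI ≤ M := by rw [hM, Real.le_sqrt (by positivity) hK0.le]; exact hKeI
    rw [div_le_iff₀ hεI] at h1
    linarith only [h1]
  have hK2 : K ≤ K ^ 2 := by nlinarith only [hK1]
  have hK3 : K ^ 2 ≤ K ^ 3 := by nlinarith only [hK1, hK2]
  have hKMK : K ≤ M * K ^ 2 := by nlinarith only [hM1, hK2, hK0]
  -- quartic pinning: the interaction regime, window `1/K`
  have hreg : 1 / 2 ≤ (limitChain lam β).hamiltonian N (rescale K z) := by
    refine limitChain_hamiltonian_ge_half_of_pos hω hl hβ hK1 ?_ hz1 hz2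
    rw [← hCΦ]
    linarith only [hKΦ', hK2]
  have hwt : 1 / K ≤ (tstar : ℝ) := by rw [one_div_le hK0 hts0]; exact hKt
  refine pinnedChain_window_decay_of_dissipation hω hl.le hβ hγ hN hTL hTR hθ hp1 hpθ tstar (K := K)
    (wr := 1 / K) (Dis := εI * K ^ 3) (κ₀ := κ₀) hK1 (by positivity)
    (by rw [div_le_one hK0]; exact hK1) hwt hκ₀0 hz2 ?_ ?_ ?_ ?_ hKcs' hbadK'
  · -- `A √K (1/K) ≤ K`
    rw [← hA, ← hM]
    calc A * M * (1 / K) ≤ A * M * 1 := by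
          refine mul_le_mul_of_nonneg_left ?_ (by positivity)
          rw [div_le_one hK0]; exact hK1
      _ ≤ K := by rw [mul_one]; exact hAM
  · intro η hη hηb
    exact hI K hKI z hz2 hreg η hη fun s hs => (hηb s hs).trans (by rw [← hM]; exact hMδ)
  · -- the energy error over the window `1/K` is `≤ CI √K K² ≤ εI K³/2`
    rw [← hA, ← hc₁, ← hB, ← hM]
    have e1 : 1 / K * M * ((A * c₁ + B) * K ^ 3) = M * (A * c₁ + B) * K ^ 2 := by
      field_simp
    have e2 : N * M * ((c₁ + 1 / 2) * K ^ 2 + M / 2) =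
        N * M * (c₁ + 1 / 2) * K ^ 2 + N * K / 2 := by
      rw [mul_add, show (N : ℝ) * M * (M / 2) = N * (M * M) / 2 by ring, hMK]; ring
    rw [e1, e2]
    have h3 : N * K / 2 ≤ N / 2 * M * K ^ 2 := by
      have := mul_le_mul_of_nonneg_left hKMK (by positivity : (0 : ℝ) ≤ N / 2)
      linarith only [this]
    have h4 : M * (A * c₁ + B) * K ^ 2 + N * M * (c₁ + 1 / 2) * K ^ 2 + N / 2 * M * K ^ 2 =
        CI * M * K ^ 2 := by
      rw [hCI]; ring
    have h5 : CI * M * K ^ 2 ≤ εI * K ^ 3 / 2 := by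
      have h6 : CI * M ≤ εI * (M * M) / 2 := by nlinarith only [hMeI, hM0]
      rw [hMK] at h6
      have h7 := mul_le_mul_of_nonneg_right h6 (sq_nonneg K)
      have e : εI * K / 2 * K ^ 2 = εI * K ^ 3 / 2 := by ring
      linarith only [h7, e]
    linarith only [h3, h4, h5]
  · -- `log(2/κ₀) ≤ θ εI K³/2`
    have h1 : 2 * L₀ ≤ θ * εI * K := by
      have := hKLI
      rw [div_le_iff₀ (by positivity)] at this
      linarith only [this]
    have h2 : K ≤ K ^ 3 := hK2.trans hK3
    have h3 := mul_le_mul_of_nonneg_left h2 (by positivity : 0 ≤ θ * εI)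
    rw [← hL₀]
    linarith only [h1, h3]

end UniformDecay

/-- **Registered sub-goal `uniformHarris_uniformH2`** of crux stmt-AtomisticToContinuum-11812 (under
`stub_uniformHarris_of_minorization`, line `gibbs-ttcf`): CEHR Remark 5.2 (H2 for `V = e^{θH}`) for the
constructed transition kernels of the pinned chain (`ω₂, lam, β, γ > 0`, `N ≥ 1`) with constants UNIFORM in the
bath temperatures `0 < T_L, T_R ≤ Tm`: for `0 < θ < 1/Tm` and `t* > 0` there is `E₁` with
`P^{T_L,T_R}_{t*} e^{θH}(z) ≤ ½ e^{θH(z)} + e^{2θγTm t*} e^{θE₁} 1_{H ≤ E₁}(z)` for all such `T_L, T_R` and all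
`z` (above `E₁` by `pinnedChain_uniform_decay`, below it by the a-priori bound (3.4)).
[cite: CuneoEckmannHairerReyBellet2018, Thm 5.1 and Rem 5.2] -/
theorem uniformHarris_uniformH2 :
    ∀ ω₂ lam β γ : ℝ, 0 < ω₂ → 0 < lam → 0 < β → 0 < γ → ∀ N : ℕ, 0 < N → ∀ Tm θ : ℝ, 0 < Tm → 0 < θ → θ < 1 / Tm → ∀ tstar : ℝ≥0, 0 < tstar → ∃ E₁ : ℝ, ∀ T_L T_R : ℝ, 0 < T_L → T_L ≤ Tm → 0 < T_R → T_R ≤ Tm → ∀ z : PhaseSpace N, ∫⁻ y, ENNReal.ofReal (Real.exp (θ * (pinnedChain ω₂ lam β γ).hamiltonian N y)) ∂((pinnedChain ω₂ lam β γ).transitionKernel N T_L T_R tstar z) ≤ ENNReal.ofReal (1 / 2 * Real.exp (θ * (pinnedChain ω₂ lam β γ).hamiltonian N z) + Real.exp (2 * θ * γ * Tm * tstar) * Real.exp (θ * E₁) * {x : PhaseSpace N | (pinnedChain ω₂ lam β γ).hamiltonian N x ≤ E₁}.indicator 1 z) := by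
  intro ω₂ lam β γ hω hl hβ hγ N hN Tm θ hTm hθ hθ' tstar htstar
  obtain ⟨E₁, hE₁⟩ := pinnedChain_uniform_decay hω hl hβ hγ hN hTm hθ hθ' tstar htstar
  refine ⟨E₁, fun T_L T_R hTL hTLm hTR hTRm z => ?_⟩
  set H := (pinnedChain ω₂ lam β γ).hamiltonian N with hH
  set c := Real.exp (2 * θ * γ * Tm * tstar) * Real.exp (θ * E₁) with hc
  have hcpos : 0 < c := by positivity
  have hind : 0 ≤ ({x | H x ≤ E₁} : Set (PhaseSpace N)).indicator (1 : PhaseSpace N → ℝ) z :=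
    Set.indicator_nonneg (fun _ _ => zero_le_one) z
  by_cases hz : E₁ ≤ H z
  · refine (hE₁ T_L T_R hTL hTLm hTR hTRm z hz).trans (ENNReal.ofReal_le_ofReal ?_)
    have : 0 ≤ c * ({x | H x ≤ E₁} : Set (PhaseSpace N)).indicator 1 z := mul_nonneg hcpos.le hind
    linarith
  · have hzK : z ∈ ({x | H x ≤ E₁} : Set (PhaseSpace N)) := le_of_lt (not_le.1 hz)
    rw [Set.indicator_of_mem hzK, Pi.one_apply, mul_one]
    have hTmax0 : 0 < max T_L T_R := lt_max_of_lt_left hTL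
    have hθ'' : θ < 1 / max T_L T_R :=
      hθ'.trans_le (one_div_le_one_div_of_le hTmax0 (max_le hTLm hTRm))
    refine (lintegral_exp_mul_hamiltonian_pinnedChainSemigroup_le hω hl.le hβ.le hγ.le hN hTL.le
      hTR.le hTL hTR hθ hθ'' tstar z).trans (ENNReal.ofReal_le_ofReal ?_)
    have h1 : Real.exp (θ * H z) ≤ Real.exp (θ * E₁) :=
      Real.exp_le_exp.2 (mul_le_mul_of_nonneg_left (le_of_lt (not_le.1 hz)) hθ.le)
    have h0 : Real.exp (θ * γ * (T_L + T_R) * tstar) ≤ Real.exp (2 * θ * γ * Tm * tstar) := by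
      refine Real.exp_le_exp.2 ?_
      have h1 : T_L + T_R ≤ Tm + Tm := add_le_add hTLm hTRm
      have h2 : 0 ≤ θ * γ := by positivity
      have h3 : (0 : ℝ) ≤ tstar := tstar.coe_nonneg
      nlinarith [mul_nonneg (mul_nonneg h2 (sub_nonneg.2 h1)) h3]
    have h2 : Real.exp (θ * γ * (T_L + T_R) * tstar) * Real.exp (θ * H z) ≤ c :=
      mul_le_mul h0 h1 (Real.exp_pos _).le (Real.exp_pos _).le
    have h3 : 0 ≤ 1 / 2 * Real.exp (θ * H z) := by positivity
    linarith

end Summit.AtomisticToContinuum.FouriersLaw.Theorems.BoundaryKubo.GibbsTtcf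

end
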